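import Mathlib.Analysis.Normed.Algebra.MatrixExponential
import Mathlib.Analysis.SpecialFunctions.Exponential
import Mathlib.Analysis.SpecialFunctions.Complex.Circle
import Mathlib.Analysis.ODE.Gronwall
import Mathlib.Analysis.Calculus.MeanValue
import Mathlib.RingTheory.Idempotents
import Literature.MathematicalPhysics.QuantumLattice.LieTrotter
import HarnessLib

/-!
# First-order averaging for matrix exponentials with a fast real-diagonalizable phase

Let `P₁, …, P_r` be complete orthogonal idempotent `m × m` complex matrices
(`CompleteOrthogonalIdempotents`), `λ₁, …, λ_r` pairwise distinct reals,
`K = Σₐ λₐ Pₐ` (a diagonalizable matrix with real spectrum and spectral projections `Pₐ`) and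
`E` any matrix. Writing `E_d = Σₐ Pₐ E Pₐ` for the block-diagonal part of `E` (which commutes
with `K`), we prove the **averaging estimate**

  `‖exp(-inK + E) - exp(-inK) exp(E_d)‖ ≤ C / n`,  `n > 0`,

with an explicit constant `C = averagingBound r B_P B_E δ` depending only on the number `r` of
projections, bounds `B_P ≥ ‖Pₐ‖`, `B_E ≥ ‖E‖` and the minimal gap `δ ≤ min_{a ≠ b} |λₐ - λ_b|`
(so that it is locally uniform when `Pₐ, λₐ, E` depend continuously on a parameter), together
with the spectral formula `exp(Σ cₐPₐ) = Σₐ e^{cₐ} Pₐ`. In particular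
`exp(-inK + E) Pₐ = e^{-inλₐ}(exp(E_d) Pₐ + O(1/n))`: to first order, the fast phase
`exp(-inK)` averages the perturbation `E` to its block-diagonal part (the elementary
finite-dimensional "interaction picture" computation; the off-diagonal blocks `Pₐ E P_b`,
`a ≠ b`, oscillate with frequency `n(λₐ - λ_b)` and contribute `O(1/n)`). Replacing `E` by
`-E` gives the form `exp(-inK - E)`.

This is the matrix-analysis input by which a zeroth-order term is removed in Rauch's linear
step [Rauch1986, Proof of Theorem p. 483, last sentence]: Rauch's multiplier at the single time
`T` is `M(ξ) = exp(-TA₀⁻¹(2πiΣξ_lA_l + B₁))`, and its dilates `M(nξ) = exp(-inK(ξ) - E)`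
(`K(ξ) = 2πTA₀⁻¹Σξ_lA_l`, `E = TA₀⁻¹B₁`) are `Lᵖ` multipliers uniformly in `n`
[BrennerThomeeWahlbin1975, Ch. 1 Thm 2.8]; the estimate reduces the asymptotics of `M(nξ)`
near a point of smooth spectral decomposition of `K(ξ)` to the case `E = 0` of
[BrennerThomeeWahlbin1975, Ch. 5 §1, proof of Lemma 1.1] (`χ exp(inλ) v = χ exp(nP̂) v`),
whereas Brenner's own treatment of lower-order terms [Brenner1973, Lemma 5.2 p. 97] lets
`t → 0` and needs the multiplier bound uniformly in `0 < t ≤ T`.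

## The proof

Matrices carry the `ℓ^∞` operator norm (`open scoped Matrix.Norms.Operator`). Abstract
version (`norm_exp_add_add_sub_exp_add_le`): for `A, E_d, E_off, Θ` with `[A, E_d] = 0` and
`ΘA - AΘ = E_off`, put `X(t) = exp(t(A + E_d + E_off))`, `Y(t) = exp(t(A + E_d))`,
`U(t) = Y(-t)X(t)`, `Ω(t) = Y(-t)ΘY(t)`. Then `U' = Y(-t)E_off X`,
`Ω' = Y(-t)(E_off + [Θ, E_d])Y(t)`, and `Z = (1 - Ω)U` has
`Z' = -Y(-t)[Θ, E_d]X - ΩY(-t)E_off X = O(‖Θ‖)`; Gronwall bounds `U` on `[0, 1]`, the mean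
value inequality bounds `Z(1) - Z(0)`, and `X(1) - Y(1) = Y(1)(U(1) - 1)` with
`U(1) - 1 = (Z(1) - Z(0)) - Θ + Ω(1)U(1) = O(‖Θ‖)`. For `A = -inK` one takes
`Θ = Σ_{a ≠ b} (in(λₐ - λ_b))⁻¹ Pₐ E P_b = O(1/n)`, which solves `ΘA - AΘ = E_off`.

## Contents

* `idempotentsRingHom`, `exp_sum_smul_idempotents` (`exp(Σ cₐPₐ) = Σ e^{cₐ}Pₐ`),
  `norm_exp_sum_smul_idempotents_le`;
* `norm_exp_le_exp_norm` (`‖exp x‖ ≤ e^{‖x‖}`, from the tree's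
  `Literature.MathematicalPhysics.QuantumLattice.norm_exp_le`);
* `norm_exp_add_add_sub_exp_add_le` (abstract averaging estimate);
* `idemBlockDiag`, `averagingCorrector`, `averagingCorrector_commutator`, `averagingBound`,
  `norm_exp_phase_add_sub_le` (the estimate for `exp(-inK + E)`) and
  `norm_exp_phase_add_mul_idem_sub_le` (the same multiplied by a projection `Pₐ`).

## References

* [Rauch1986] J. Rauch, Comm. Math. Phys. 106 (1986) 481–484, Proof of Theorem p. 483.
* [BrennerThomeeWahlbin1975] P. Brenner, V. Thomée, L. B. Wahlbin, LNM 434 (1975), Ch. 1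
  Thm 2.8; Ch. 5 §1 Lemma 1.1 (proof).
* [Brenner1973] P. Brenner, Ark. Mat. 11 (1973) 75–101, Lemma 5.2 p. 97.
-/

noncomputable section

open NormedSpace Set
open scoped Matrix.Norms.Operator

namespace Literature.Analysis.ODE

variable {m : Type*} [Fintype m] [DecidableEq m]

/-! ### Spectral calculus of complete orthogonal idempotents -/

section Idempotents

variable {r : ℕ} {P : Fin r → Matrix m m ℂ}

/-- Products of combinations of orthogonal idempotents: `(Σ cₐPₐ)(Σ d_bP_b) = Σ cₐdₐPₐ`.
[folklore] -/
theorem sum_smul_mul_sum_smul (hP : CompleteOrthogonalIdempotents P) (c d : Fin r → ℂ) :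
    (∑ a, c a • P a) * (∑ b, d b • P b) = ∑ a, (c a * d a) • P a := by
  rw [Finset.sum_mul_sum]
  refine Finset.sum_congr rfl fun a _ => ?_
  rw [Finset.sum_eq_single a]
  · rw [smul_mul_smul_comm, (hP.idem a).eq]
  · intro b _ hba
    rw [smul_mul_smul_comm, hP.ortho (Ne.symm hba), smul_zero]
  · intro h; exact absurd (Finset.mem_univ a) h

/-- The unital ring homomorphism `c ↦ Σₐ cₐ Pₐ` from `ℂʳ` defined by a complete family of
orthogonal idempotents. [folklore] -/
def idempotentsRingHom (hP : CompleteOrthogonalIdempotents P) :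
    (Fin r → ℂ) →+* Matrix m m ℂ where
  toFun c := ∑ a, c a • P a
  map_one' := by simp [hP.complete]
  map_mul' c d := by
    rw [sum_smul_mul_sum_smul hP]
    rfl
  map_zero' := by simp
  map_add' c d := by
    simp only [Pi.add_apply, add_smul, Finset.sum_add_distrib]

/-- Unfolding `idempotentsRingHom`. [folklore] -/
theorem idempotentsRingHom_apply (hP : CompleteOrthogonalIdempotents P) (c : Fin r → ℂ) :
    idempotentsRingHom hP c = ∑ a, c a • P a := rfl

/-- **Spectral formula**: `exp(Σₐ cₐ Pₐ) = Σₐ e^{cₐ} Pₐ` (a continuous ring homomorphism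
commutes with `exp`). [folklore] -/
theorem exp_sum_smul_idempotents (hP : CompleteOrthogonalIdempotents P) (c : Fin r → ℂ) :
    exp (∑ a, c a • P a) = ∑ a, Complex.exp (c a) • P a := by
  have hcont : Continuous (idempotentsRingHom hP) := by
    change Continuous fun c : Fin r → ℂ => ∑ a, c a • P a
    fun_prop
  have h := map_exp (idempotentsRingHom hP) hcont c
  rw [idempotentsRingHom_apply, idempotentsRingHom_apply, Pi.exp_def] at h
  calc exp (∑ a, c a • P a) = ∑ a, (fun i => exp (c i)) a • P a := h.symm
    _ = ∑ a, Complex.exp (c a) • P a := by simp [Complex.exp_eq_exp_ℂ]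

/-- `Pₐ exp(Σ c_bP_b) = e^{cₐ} Pₐ`. [folklore] -/
theorem idempotent_mul_exp_sum_smul (hP : CompleteOrthogonalIdempotents P) (c : Fin r → ℂ)
    (a : Fin r) : P a * exp (∑ b, c b • P b) = Complex.exp (c a) • P a := by
  rw [exp_sum_smul_idempotents hP, Finset.mul_sum, Finset.sum_eq_single a]
  · rw [Matrix.mul_smul, (hP.idem a).eq]
  · intro b _ hba
    rw [Matrix.mul_smul, hP.ortho (Ne.symm hba), smul_zero]
  · intro h; exact absurd (Finset.mem_univ a) h

/-- `exp(Σ c_bP_b) Pₐ = e^{cₐ} Pₐ`. [folklore] -/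
theorem exp_sum_smul_mul_idempotent (hP : CompleteOrthogonalIdempotents P) (c : Fin r → ℂ)
    (a : Fin r) : exp (∑ b, c b • P b) * P a = Complex.exp (c a) • P a := by
  rw [exp_sum_smul_idempotents hP, Finset.sum_mul, Finset.sum_eq_single a]
  · rw [Matrix.smul_mul, (hP.idem a).eq]
  · intro b _ hba
    rw [Matrix.smul_mul, hP.ortho hba, smul_zero]
  · intro h; exact absurd (Finset.mem_univ a) h

/-- Norm of `exp(Σ cₐPₐ)` for unimodular `e^{cₐ}` (purely imaginary `cₐ`): at most `r B` if
`‖Pₐ‖ ≤ B`. [folklore] -/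
theorem norm_exp_sum_smul_idempotents_le (hP : CompleteOrthogonalIdempotents P)
    (c : Fin r → ℂ) (hc : ∀ a, ‖Complex.exp (c a)‖ = 1) {B : ℝ} (hB : ∀ a, ‖P a‖ ≤ B) :
    ‖exp (∑ a, c a • P a)‖ ≤ r * B := by
  rw [exp_sum_smul_idempotents hP]
  calc ‖∑ a, Complex.exp (c a) • P a‖ ≤ ∑ a, ‖Complex.exp (c a) • P a‖ := norm_sum_le _ _
    _ ≤ ∑ _a : Fin r, B := Finset.sum_le_sum fun a _ => by
        rw [norm_smul, hc a, one_mul]; exact hB a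
    _ = r * B := by simp

end Idempotents

/-! ### `‖exp x‖ ≤ e^{‖x‖}` -/

/-- In the normed algebra of matrices (`ℓ^∞` operator norm), `‖exp x‖ ≤ e^{‖x‖}` — the tree's
`Literature.MathematicalPhysics.QuantumLattice.norm_exp_le` (any complete normed algebra with
`‖1‖ = 1`), specialised. [folklore] -/
theorem norm_exp_le_exp_norm [Nonempty m] (x : Matrix m m ℂ) : ‖exp x‖ ≤ Real.exp ‖x‖ :=
  Literature.MathematicalPhysics.QuantumLattice.norm_exp_le ℝ x

/-! ### The abstract averaging estimate -/

/-- `exp(tM) exp(t(-M)) = 1`. [folklore] -/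
theorem exp_smul_mul_exp_smul_neg (M : Matrix m m ℂ) (t : ℝ) :
    exp (t • M) * exp (t • (-M)) = 1 := by
  have h : exp (t • M + t • (-M)) = exp (t • M) * exp (t • (-M)) :=
    Matrix.exp_add_of_commute _ _ (((Commute.refl M).neg_right.smul_left t).smul_right t)
  have h0 : exp (0 : Matrix m m ℂ) = 1 := exp_zero
  rw [← h, smul_neg, add_neg_cancel, h0]

/-- `exp(t(-M)) exp(tM) = 1`. [folklore] -/
theorem exp_smul_neg_mul_exp_smul (M : Matrix m m ℂ) (t : ℝ) :
    exp (t • (-M)) * exp (t • M) = 1 := by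
  have h : exp (t • (-M) + t • M) = exp (t • (-M)) * exp (t • M) :=
    Matrix.exp_add_of_commute _ _ (((Commute.refl M).neg_left.smul_left t).smul_right t)
  have h0 : exp (0 : Matrix m m ℂ) = 1 := exp_zero
  rw [← h, smul_neg, neg_add_cancel, h0]

/-- Norm of `exp(t(A + E_d))` for commuting `A, E_d` and `|t| ≤ 1`: if `‖exp(tA)‖ ≤ B_A` and
`‖E_d‖ ≤ B_d` then `‖exp(t(A + E_d))‖ ≤ B_A e^{B_d}`. [folklore] -/
theorem norm_exp_smul_add_le [Nonempty m] {A Ed : Matrix m m ℂ} (hc : Commute A Ed)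
    {BA Bd : ℝ} {t : ℝ} (hA : ‖exp (t • A)‖ ≤ BA) (hBd : ‖Ed‖ ≤ Bd) (ht : |t| ≤ 1)
    (hBA : 0 ≤ BA) : ‖exp (t • (A + Ed))‖ ≤ BA * Real.exp Bd := by
  have h : exp (t • A + t • Ed) = exp (t • A) * exp (t • Ed) :=
    Matrix.exp_add_of_commute _ _ ((hc.smul_left t).smul_right t)
  rw [smul_add, h]
  refine (norm_mul_le _ _).trans (mul_le_mul hA ?_ (norm_nonneg _) hBA)
  refine (norm_exp_le_exp_norm _).trans (Real.exp_le_exp.2 ?_)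
  rw [norm_smul, Real.norm_eq_abs]
  calc |t| * ‖Ed‖ ≤ 1 * Bd := mul_le_mul ht hBd (norm_nonneg _) zero_le_one
    _ = Bd := one_mul _

/-- **Abstract first-order averaging estimate.** Let `A, E_d, E_off, Θ` be matrices with
`[A, E_d] = 0` and `ΘA - AΘ = E_off`, and suppose `‖exp(tA)‖ ≤ B_A` for `|t| ≤ 1`,
`‖E_d‖ ≤ B_d`, `‖E_off‖ ≤ B_o`, `‖Θ‖ ≤ θ`. Then
`‖exp(A + E_d + E_off) - exp(A + E_d)‖ ≤ C(B_A, B_d, B_o) θ` with the explicit constant below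
(interaction picture `U = Y(-t)X(t)`, corrector `Ω = Y(-t)ΘY(t)`, Gronwall and the mean value
inequality; see the module docstring). [folklore] -/
theorem norm_exp_add_add_sub_exp_add_le [Nonempty m] {A Ed Eoff Θ : Matrix m m ℂ}
    (hc : Commute A Ed) (hΘ : Θ * A - A * Θ = Eoff) {BA Bd Bo θ : ℝ}
    (hA : ∀ t : ℝ, |t| ≤ 1 → ‖exp (t • A)‖ ≤ BA) (hBd : ‖Ed‖ ≤ Bd) (hBo : ‖Eoff‖ ≤ Bo)
    (hθ : ‖Θ‖ ≤ θ) :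
    ‖exp (A + Ed + Eoff) - exp (A + Ed)‖ ≤
      (BA * Real.exp Bd) * (θ *
        ((2 * Bd * (BA * Real.exp Bd) + (BA * Real.exp Bd) ^ 3 * Bo) *
            ((BA * Real.exp Bd) * Real.exp ((BA * Real.exp Bd) ^ 2 * Bo))
          + 1 + (BA * Real.exp Bd) ^ 2 * Real.exp ((BA * Real.exp Bd) ^ 2 * Bo))) := by
  -- nonnegativity of the bounds
  have hBA : 0 ≤ BA := (norm_nonneg _).trans (hA 0 (by simp))
  have hBd0 : 0 ≤ Bd := (norm_nonneg _).trans hBd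
  have hBo0 : 0 ≤ Bo := (norm_nonneg _).trans hBo
  have hθ0 : 0 ≤ θ := (norm_nonneg _).trans hθ
  set BY : ℝ := BA * Real.exp Bd with hBY
  have hBY0 : 0 ≤ BY := mul_nonneg hBA (Real.exp_pos _).le
  set MU : ℝ := Real.exp (BY ^ 2 * Bo) with hMU
  have hMU1 : 1 ≤ MU := Real.one_le_exp (by positivity)
  have hMU0 : 0 ≤ MU := zero_le_one.trans hMU1
  -- the players
  set G : Matrix m m ℂ := A + Ed with hG
  set X : ℝ → Matrix m m ℂ := fun t => exp (t • (G + Eoff)) with hX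
  set Y : ℝ → Matrix m m ℂ := fun t => exp (t • G) with hY
  set Ym : ℝ → Matrix m m ℂ := fun t => exp (t • (-G)) with hYm
  set U : ℝ → Matrix m m ℂ := fun t => Ym t * X t with hU
  set Ω : ℝ → Matrix m m ℂ := fun t => Ym t * Θ * Y t with hΩ
  set Z : ℝ → Matrix m m ℂ := fun t => U t - Ω t * U t with hZ
  have hexp0 : exp (0 : Matrix m m ℂ) = 1 := exp_zero
  -- algebraic identities
  have hYYm : ∀ t, Y t * Ym t = 1 := fun t => exp_smul_mul_exp_smul_neg G t
  have hXU : ∀ t, X t = Y t * U t := fun t => by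
    simp only [hU, ← mul_assoc, hYYm, one_mul]
  have hX0 : X 0 = 1 := by simp only [hX, zero_smul, hexp0]
  have hY0 : Y 0 = 1 := by simp only [hY, zero_smul, hexp0]
  have hYm0 : Ym 0 = 1 := by simp only [hYm, zero_smul, hexp0]
  have hU0 : U 0 = 1 := by simp only [hU, hX0, hYm0, mul_one]
  have hΩ0 : Ω 0 = Θ := by simp only [hΩ, hY0, hYm0, mul_one, one_mul]
  have hX1 : X 1 = exp (A + Ed + Eoff) := by simp only [hX, hG, one_smul]
  have hY1 : Y 1 = exp (A + Ed) := by simp only [hY, hG, one_smul]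
  -- norm bounds for `Y`, `Ym` for `|t| ≤ 1`
  have hYb : ∀ t : ℝ, |t| ≤ 1 → ‖Y t‖ ≤ BY := fun t ht =>
    norm_exp_smul_add_le hc (hA t ht) hBd ht hBA
  have hYmb : ∀ t : ℝ, |t| ≤ 1 → ‖Ym t‖ ≤ BY := fun t ht => by
    have h : Ym t = exp ((-t) • (A + Ed)) := by simp only [hYm, hG, smul_neg, neg_smul]
    rw [h]
    exact norm_exp_smul_add_le hc (hA (-t) (by rwa [abs_neg])) hBd (by rwa [abs_neg]) hBA
  have habs : ∀ {t : ℝ}, t ∈ Icc (0 : ℝ) 1 → |t| ≤ 1 := fun ht => by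
    rw [abs_of_nonneg ht.1]; exact ht.2
  have hIco : ∀ {t : ℝ}, t ∈ Ico (0 : ℝ) 1 → t ∈ Icc (0 : ℝ) 1 := fun ht =>
    Ico_subset_Icc_self ht
  -- derivatives
  have hXd : ∀ t, HasDerivAt X ((G + Eoff) * X t) t := fun t =>
    hasDerivAt_exp_smul_const' (𝕂 := ℝ) (G + Eoff) t
  have hYd : ∀ t, HasDerivAt Y (G * Y t) t := fun t =>
    hasDerivAt_exp_smul_const' (𝕂 := ℝ) G t
  have hYmd : ∀ t, HasDerivAt Ym (Ym t * (-G)) t := fun t =>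
    hasDerivAt_exp_smul_const (𝕂 := ℝ) (-G) t
  have hUd : ∀ t, HasDerivAt U (Ym t * Eoff * X t) t := fun t => by
    have h := (hYmd t).mul (hXd t)
    have he : Ym t * -G * X t + Ym t * ((G + Eoff) * X t) = Ym t * Eoff * X t := by
      noncomm_ring
    rwa [he] at h
  have hΩd : ∀ t, HasDerivAt Ω (Ym t * (Eoff + (Θ * Ed - Ed * Θ)) * Y t) t := fun t => by
    have h := ((hYmd t).mul_const Θ).mul (hYd t)
    have he : Ym t * -G * Θ * Y t + Ym t * Θ * (G * Y t) =
        Ym t * (Eoff + (Θ * Ed - Ed * Θ)) * Y t := by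
      rw [← hΘ, hG]; noncomm_ring
    rwa [he] at h
  have hZd : ∀ t, HasDerivAt Z
      (-(Ym t * (Θ * Ed - Ed * Θ) * X t) - Ω t * (Ym t * Eoff * X t)) t := fun t => by
    have h := (hUd t).sub ((hΩd t).mul (hUd t))
    have he : Ym t * Eoff * X t -
        (Ym t * (Eoff + (Θ * Ed - Ed * Θ)) * Y t * U t + Ω t * (Ym t * Eoff * X t)) =
        -(Ym t * (Θ * Ed - Ed * Θ) * X t) - Ω t * (Ym t * Eoff * X t) := by
      rw [hXU t]; noncomm_ring
    rwa [he] at h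
  -- Gronwall bound for `U` on `[0, 1]`
  have hUcont : ContinuousOn U (Icc 0 1) := fun t _ => (hUd t).continuousAt.continuousWithinAt
  have hUgr : ∀ t ∈ Icc (0 : ℝ) 1, ‖U t‖ ≤ MU := by
    intro t ht
    have h := norm_le_gronwallBound_of_norm_deriv_right_le (f := U)
      (f' := fun t => Ym t * Eoff * X t) (δ := 1) (K := BY ^ 2 * Bo) (ε := 0) (a := 0)
      (b := 1) hUcont (fun s _ => (hUd s).hasDerivWithinAt) (by rw [hU0, norm_one])
      (fun s hs => ?_) t ht
    · rw [gronwallBound_ε0, one_mul, sub_zero] at h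
      refine h.trans (Real.exp_le_exp.2 ?_)
      calc BY ^ 2 * Bo * t ≤ BY ^ 2 * Bo * 1 :=
            mul_le_mul_of_nonneg_left ht.2 (by positivity)
        _ = BY ^ 2 * Bo := mul_one _
    · rw [add_zero]
      calc ‖Ym s * Eoff * X s‖ ≤ ‖Ym s‖ * ‖Eoff‖ * ‖X s‖ :=
            (norm_mul_le _ _).trans (mul_le_mul_of_nonneg_right (norm_mul_le _ _) (norm_nonneg _))
        _ ≤ BY * Bo * (BY * ‖U s‖) := by
            refine mul_le_mul (mul_le_mul (hYmb s (habs (hIco hs))) hBo (norm_nonneg _) hBY0)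
              ?_ (norm_nonneg _) (by positivity)
            rw [hXU s]
            exact (norm_mul_le _ _).trans
              (mul_le_mul_of_nonneg_right (hYb s (habs (hIco hs))) (norm_nonneg _))
        _ = BY ^ 2 * Bo * ‖U s‖ := by ring
  have hXb : ∀ t ∈ Icc (0 : ℝ) 1, ‖X t‖ ≤ BY * MU := fun t ht => by
    rw [hXU t]
    exact (norm_mul_le _ _).trans (mul_le_mul (hYb t (habs ht)) (hUgr t ht) (norm_nonneg _) hBY0)
  have hΩb : ∀ t ∈ Icc (0 : ℝ) 1, ‖Ω t‖ ≤ BY * θ * BY := fun t ht =>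
    (norm_mul_le _ _).trans (mul_le_mul ((norm_mul_le _ _).trans
      (mul_le_mul (hYmb t (habs ht)) hθ (norm_nonneg _) hBY0)) (hYb t (habs ht))
      (norm_nonneg _) (by positivity))
  have hcomm : ‖Θ * Ed - Ed * Θ‖ ≤ 2 * θ * Bd := by
    calc ‖Θ * Ed - Ed * Θ‖ ≤ ‖Θ * Ed‖ + ‖Ed * Θ‖ := norm_sub_le _ _
      _ ≤ ‖Θ‖ * ‖Ed‖ + ‖Ed‖ * ‖Θ‖ := add_le_add (norm_mul_le _ _) (norm_mul_le _ _)
      _ ≤ θ * Bd + Bd * θ := add_le_add (mul_le_mul hθ hBd (norm_nonneg _) hθ0)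
          (mul_le_mul hBd hθ (norm_nonneg _) hBd0)
      _ = 2 * θ * Bd := by ring
  -- mean value inequality for `Z` on `[0, 1]`
  set C₁ : ℝ := (2 * Bd * BY + BY ^ 3 * Bo) * (BY * MU) with hC₁
  have hZ' : ∀ t ∈ Ico (0 : ℝ) 1,
      ‖-(Ym t * (Θ * Ed - Ed * Θ) * X t) - Ω t * (Ym t * Eoff * X t)‖ ≤ θ * C₁ := by
    intro t ht
    have ht' := hIco ht
    have h1 : ‖Ym t * (Θ * Ed - Ed * Θ) * X t‖ ≤ BY * (2 * θ * Bd) * (BY * MU) :=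
      (norm_mul_le _ _).trans (mul_le_mul ((norm_mul_le _ _).trans
        (mul_le_mul (hYmb t (habs ht')) hcomm (norm_nonneg _) hBY0)) (hXb t ht')
        (norm_nonneg _) (by positivity))
    have h2 : ‖Ω t * (Ym t * Eoff * X t)‖ ≤ (BY * θ * BY) * (BY * Bo * (BY * MU)) :=
      (norm_mul_le _ _).trans (mul_le_mul (hΩb t ht') ((norm_mul_le _ _).trans
        (mul_le_mul ((norm_mul_le _ _).trans (mul_le_mul (hYmb t (habs ht')) hBo
          (norm_nonneg _) hBY0)) (hXb t ht') (norm_nonneg _) (by positivity)))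
        (norm_nonneg _) (by positivity))
    calc ‖-(Ym t * (Θ * Ed - Ed * Θ) * X t) - Ω t * (Ym t * Eoff * X t)‖
        = ‖Ym t * (Θ * Ed - Ed * Θ) * X t + Ω t * (Ym t * Eoff * X t)‖ := by
          rw [← neg_add', norm_neg]
      _ ≤ ‖Ym t * (Θ * Ed - Ed * Θ) * X t‖ + ‖Ω t * (Ym t * Eoff * X t)‖ := norm_add_le _ _
      _ ≤ BY * (2 * θ * Bd) * (BY * MU) + (BY * θ * BY) * (BY * Bo * (BY * MU)) :=
          add_le_add h1 h2
      _ = θ * C₁ := by rw [hC₁]; ring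
  have hMVT : ‖Z 1 - Z 0‖ ≤ θ * C₁ :=
    norm_image_sub_le_of_norm_deriv_le_segment_01' (fun t _ => (hZd t).hasDerivWithinAt) hZ'
  -- conclusion
  have hZ0 : Z 0 = 1 - Θ := by simp only [hZ, hU0, hΩ0, mul_one]
  have hkey : U 1 - 1 = (Z 1 - Z 0) + Ω 1 * U 1 - Θ := by
    rw [hZ0]; simp only [hZ]; abel
  have h01 : (1 : ℝ) ∈ Icc (0 : ℝ) 1 := ⟨zero_le_one, le_rfl⟩
  have hU1 : ‖U 1 - 1‖ ≤ θ * C₁ + BY * θ * BY * MU + θ := by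
    rw [hkey]
    calc ‖Z 1 - Z 0 + Ω 1 * U 1 - Θ‖ ≤ ‖Z 1 - Z 0 + Ω 1 * U 1‖ + ‖Θ‖ := norm_sub_le _ _
      _ ≤ ‖Z 1 - Z 0‖ + ‖Ω 1 * U 1‖ + ‖Θ‖ := by gcongr; exact norm_add_le _ _
      _ ≤ θ * C₁ + BY * θ * BY * MU + θ := by
          refine add_le_add (add_le_add hMVT ?_) hθ
          exact (norm_mul_le _ _).trans (mul_le_mul (hΩb 1 h01) (hUgr 1 h01) (norm_nonneg _)
            (by positivity))
  have hfin : exp (A + Ed + Eoff) - exp (A + Ed) = Y 1 * (U 1 - 1) := by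
    rw [← hX1, ← hY1, hXU 1, mul_sub, mul_one]
  rw [hfin]
  calc ‖Y 1 * (U 1 - 1)‖ ≤ ‖Y 1‖ * ‖U 1 - 1‖ := norm_mul_le _ _
    _ ≤ BY * (θ * C₁ + BY * θ * BY * MU + θ) :=
        mul_le_mul (hYb 1 (by simp)) hU1 (norm_nonneg _) hBY0
    _ = BY * (θ * (C₁ + 1 + BY ^ 2 * MU)) := by ring

/-! ### The estimate for `exp(-inK + E)` -/

section Phase

variable {r : ℕ} {P : Fin r → Matrix m m ℂ}

/-- The block-diagonal part `Σₐ Pₐ E Pₐ` of `E` with respect to a family of idempotents.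
[folklore] -/
def idemBlockDiag (P : Fin r → Matrix m m ℂ) (E : Matrix m m ℂ) : Matrix m m ℂ :=
  ∑ a, P a * E * P a

/-- The corrector `Θ = Σ_{a ≠ b} (in(λₐ - λ_b))⁻¹ Pₐ E P_b` solving `ΘA - AΘ = E - E_d` for
`A = -in Σ λₐPₐ`. [folklore] -/
def averagingCorrector (P : Fin r → Matrix m m ℂ) (lam : Fin r → ℝ) (E : Matrix m m ℂ)
    (n : ℝ) : Matrix m m ℂ :=
  ∑ a, ∑ b, if a = b then 0 else
    ((Complex.I * n * ((lam a : ℂ) - lam b))⁻¹) • (P a * E * P b)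

/-- `P_b (Σ α_c P_c) = α_b P_b`. [folklore] -/
theorem idem_mul_sum_smul (hP : CompleteOrthogonalIdempotents P) (α : Fin r → ℂ) (b : Fin r) :
    P b * ∑ c, α c • P c = α b • P b := by
  rw [Finset.mul_sum, Finset.sum_eq_single b]
  · rw [Matrix.mul_smul, (hP.idem b).eq]
  · intro c _ hcb; rw [Matrix.mul_smul, hP.ortho (Ne.symm hcb), smul_zero]
  · intro h; exact absurd (Finset.mem_univ b) h

/-- `(Σ α_c P_c) P_a = α_a P_a`. [folklore] -/
theorem sum_smul_mul_idem (hP : CompleteOrthogonalIdempotents P) (α : Fin r → ℂ) (a : Fin r) :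
    (∑ c, α c • P c) * P a = α a • P a := by
  rw [Finset.sum_mul, Finset.sum_eq_single a]
  · rw [Matrix.smul_mul, (hP.idem a).eq]
  · intro c _ hca; rw [Matrix.smul_mul, hP.ortho hca, smul_zero]
  · intro h; exact absurd (Finset.mem_univ a) h

/-- `Σₐ Σ_b Pₐ E P_b = E`. [folklore] -/
theorem sum_sum_idem_mul_mul_idem (hP : CompleteOrthogonalIdempotents P) (E : Matrix m m ℂ) :
    ∑ a, ∑ b, P a * E * P b = E := by
  have h : ∀ a, ∑ b, P a * E * P b = P a * E := fun a => by
    rw [← Finset.mul_sum, hP.complete, mul_one]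
  simp_rw [h]
  rw [← Finset.sum_mul, hP.complete, one_mul]

/-- Each `P_c` commutes with the block-diagonal part. [folklore] -/
theorem idem_commute_idemBlockDiag (hP : CompleteOrthogonalIdempotents P) (E : Matrix m m ℂ)
    (c : Fin r) : Commute (P c) (idemBlockDiag P E) := by
  unfold idemBlockDiag
  refine Commute.sum_right _ _ _ fun a _ => ?_
  by_cases hca : c = a
  · subst hca
    change P c * (P c * E * P c) = P c * E * P c * P c
    rw [← mul_assoc, ← mul_assoc, (hP.idem c).eq, mul_assoc (P c * E), (hP.idem c).eq]
  · change P c * (P a * E * P a) = P a * E * P a * P c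
    rw [← mul_assoc, ← mul_assoc, hP.ortho hca, zero_mul, zero_mul, mul_assoc,
      hP.ortho (Ne.symm hca), mul_zero]

/-- `Σ αₐPₐ` commutes with the block-diagonal part. [folklore] -/
theorem sum_smul_commute_idemBlockDiag (hP : CompleteOrthogonalIdempotents P) (E : Matrix m m ℂ)
    (α : Fin r → ℂ) : Commute (∑ a, α a • P a) (idemBlockDiag P E) :=
  Commute.sum_left _ _ _ fun a _ => (idem_commute_idemBlockDiag hP E a).smul_left (α a)

/-- The commutator identity `ΘA - AΘ = E - E_d` for `A = Σ αₐPₐ`, `αₐ = -inλₐ`, and the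
corrector `Θ` (for pairwise distinct `λₐ` and `n ≠ 0`). [folklore] -/
theorem averagingCorrector_commutator (hP : CompleteOrthogonalIdempotents P) {lam : Fin r → ℝ}
    (hlam : Function.Injective lam) (E : Matrix m m ℂ) {n : ℝ} (hn : n ≠ 0) :
    averagingCorrector P lam E n * (∑ a, (-(Complex.I * n * lam a)) • P a) -
      (∑ a, (-(Complex.I * n * lam a)) • P a) * averagingCorrector P lam E n =
      E - idemBlockDiag P E := by
  set α : Fin r → ℂ := fun a => -(Complex.I * n * lam a) with hα
  set θc : Fin r → Fin r → ℂ := fun a b => (Complex.I * n * ((lam a : ℂ) - lam b))⁻¹ with hθc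
  have hne : ∀ a b, a ≠ b → Complex.I * n * ((lam a : ℂ) - lam b) ≠ 0 := fun a b hab => by
    refine mul_ne_zero (mul_ne_zero Complex.I_ne_zero (by exact_mod_cast hn)) ?_
    rw [sub_ne_zero]
    exact_mod_cast fun h => hab (hlam h)
  -- `Θ A`
  have h1 : averagingCorrector P lam E n * (∑ a, α a • P a) =
      ∑ a, ∑ b, if a = b then 0 else (θc a b * α b) • (P a * E * P b) := by
    unfold averagingCorrector
    rw [Finset.sum_mul]
    refine Finset.sum_congr rfl fun a _ => ?_
    rw [Finset.sum_mul]
    refine Finset.sum_congr rfl fun b _ => ?_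
    split_ifs with hab
    · rw [zero_mul]
    · rw [Matrix.smul_mul, Matrix.mul_assoc (P a * E), idem_mul_sum_smul hP α b,
        Matrix.mul_smul, smul_smul]
  -- `A Θ`
  have h2 : (∑ a, α a • P a) * averagingCorrector P lam E n =
      ∑ a, ∑ b, if a = b then 0 else (α a * θc a b) • (P a * E * P b) := by
    unfold averagingCorrector
    rw [Finset.mul_sum]
    refine Finset.sum_congr rfl fun a _ => ?_
    rw [Finset.mul_sum]
    refine Finset.sum_congr rfl fun b _ => ?_
    split_ifs with hab
    · rw [mul_zero]
    · rw [Matrix.mul_smul, ← Matrix.mul_assoc, ← Matrix.mul_assoc, sum_smul_mul_idem hP α a,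
        Matrix.smul_mul, Matrix.smul_mul, smul_smul, mul_comm (θc a b)]
  -- the difference
  have hite : ∀ (f : Fin r → Fin r → Matrix m m ℂ) (a : Fin r),
      ∑ b, (if a = b then 0 else f a b) = ∑ b, f a b - f a a := fun f a => by
    rw [← Finset.sum_erase_eq_sub (Finset.mem_univ a), ← Finset.sum_erase Finset.univ
      (f := fun b => if a = b then 0 else f a b) (a := a) (by simp)]
    exact Finset.sum_congr rfl fun b hb => if_neg (Ne.symm (Finset.ne_of_mem_erase hb))
  rw [h1, h2, ← Finset.sum_sub_distrib]
  have h3 : ∀ a, (∑ b, (if a = b then (0 : Matrix m m ℂ) else (θc a b * α b) • (P a * E * P b))) -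
      ∑ b, (if a = b then (0 : Matrix m m ℂ) else (α a * θc a b) • (P a * E * P b)) =
      ∑ b, P a * E * P b - P a * E * P a := fun a => by
    rw [← Finset.sum_sub_distrib, ← hite (fun a b => P a * E * P b) a]
    refine Finset.sum_congr rfl fun b _ => ?_
    split_ifs with hab
    · rw [sub_zero]
    · rw [← sub_smul]
      have hcoef : θc a b * α b - α a * θc a b = 1 := by
        simp only [hθc, hα]
        rw [mul_comm (-(Complex.I * n * lam a)), ← mul_sub, neg_sub_neg, ← mul_sub,
          inv_mul_cancel₀ (hne a b hab)]
      rw [hcoef, one_smul]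
  simp_rw [h3]
  rw [Finset.sum_sub_distrib, sum_sum_idem_mul_mul_idem hP E]
  rfl

/-- Norm of the corrector: `‖Θ‖ ≤ r² B_P² ‖E‖ / (n δ)` if `‖Pₐ‖ ≤ B_P` and the gaps are
`≥ δ > 0`, `n > 0`. [folklore] -/
theorem norm_averagingCorrector_le {lam : Fin r → ℝ} {δ : ℝ} (hδ : 0 < δ)
    (hgap : ∀ a b, a ≠ b → δ ≤ |lam a - lam b|) {BP : ℝ} (hBP : ∀ a, ‖P a‖ ≤ BP)
    (E : Matrix m m ℂ) {n : ℝ} (hn : 0 < n) :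
    ‖averagingCorrector P lam E n‖ ≤ (r : ℝ) ^ 2 * BP ^ 2 * ‖E‖ / (n * δ) := by
  have hBP0 : ∀ a, 0 ≤ BP := fun a => (norm_nonneg _).trans (hBP a)
  unfold averagingCorrector
  have hterm : ∀ a b, ‖(if a = b then (0 : Matrix m m ℂ) else
      ((Complex.I * n * ((lam a : ℂ) - lam b))⁻¹) • (P a * E * P b))‖ ≤
      BP ^ 2 * ‖E‖ / (n * δ) := by
    intro a b
    rcases isEmpty_or_nonempty (Fin r) with hr | ⟨⟨a₀⟩⟩
    · exact (IsEmpty.false a).elim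
    split_ifs with hab
    · rw [norm_zero]; exact div_nonneg (by have := hBP0 a₀; positivity) (by positivity)
    · rw [norm_smul, norm_inv, norm_mul, norm_mul, Complex.norm_I, one_mul,
        Complex.norm_real, Real.norm_eq_abs, abs_of_pos hn, ← Complex.ofReal_sub,
        Complex.norm_real, Real.norm_eq_abs]
      have hg := hgap a b hab
      have hgpos : 0 < |lam a - lam b| := hδ.trans_le hg
      calc (n * |lam a - lam b|)⁻¹ * ‖P a * E * P b‖
          ≤ (n * δ)⁻¹ * (BP * ‖E‖ * BP) := by
            refine mul_le_mul ?_ ?_ (norm_nonneg _) (by positivity)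
            · exact inv_anti₀ (by positivity) (mul_le_mul_of_nonneg_left hg hn.le)
            · exact (norm_mul_le _ _).trans (mul_le_mul ((norm_mul_le _ _).trans
                (mul_le_mul (hBP a) le_rfl (norm_nonneg _) (hBP0 a))) (hBP b) (norm_nonneg _)
                (by have := hBP0 a; positivity))
        _ = BP ^ 2 * ‖E‖ / (n * δ) := by ring
  calc ‖∑ a, ∑ b, (if a = b then (0 : Matrix m m ℂ) else
        ((Complex.I * n * ((lam a : ℂ) - lam b))⁻¹) • (P a * E * P b))‖
      ≤ ∑ a, ∑ b, ‖(if a = b then (0 : Matrix m m ℂ) else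
        ((Complex.I * n * ((lam a : ℂ) - lam b))⁻¹) • (P a * E * P b))‖ :=
        (norm_sum_le _ _).trans (Finset.sum_le_sum fun a _ => norm_sum_le _ _)
    _ ≤ ∑ _a : Fin r, ∑ _b : Fin r, BP ^ 2 * ‖E‖ / (n * δ) :=
        Finset.sum_le_sum fun a _ => Finset.sum_le_sum fun b _ => hterm a b
    _ = (r : ℝ) ^ 2 * BP ^ 2 * ‖E‖ / (n * δ) := by
        simp only [Finset.sum_const, Finset.card_univ, Fintype.card_fin, nsmul_eq_mul]; ring

/-- Norm of the block-diagonal part: `‖E_d‖ ≤ r B_P² ‖E‖`. [folklore] -/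
theorem norm_idemBlockDiag_le {BP : ℝ} (hBP : ∀ a, ‖P a‖ ≤ BP) (E : Matrix m m ℂ) :
    ‖idemBlockDiag P E‖ ≤ r * BP ^ 2 * ‖E‖ := by
  have hBP0 : ∀ a, 0 ≤ BP := fun a => (norm_nonneg _).trans (hBP a)
  unfold idemBlockDiag
  calc ‖∑ a, P a * E * P a‖ ≤ ∑ a, ‖P a * E * P a‖ := norm_sum_le _ _
    _ ≤ ∑ _a : Fin r, BP ^ 2 * ‖E‖ := Finset.sum_le_sum fun a _ => by
        calc ‖P a * E * P a‖ ≤ ‖P a‖ * ‖E‖ * ‖P a‖ :=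
              (norm_mul_le _ _).trans (mul_le_mul_of_nonneg_right (norm_mul_le _ _) (norm_nonneg _))
          _ ≤ BP * ‖E‖ * BP := mul_le_mul (mul_le_mul_of_nonneg_right (hBP a) (norm_nonneg _))
              (hBP a) (norm_nonneg _) (by have := hBP0 a; positivity)
          _ = BP ^ 2 * ‖E‖ := by ring
    _ = r * BP ^ 2 * ‖E‖ := by
        simp only [Finset.sum_const, Finset.card_univ, Fintype.card_fin, nsmul_eq_mul]; ring

omit [Fintype m] [DecidableEq m] in
/-- `-(in) Σ λₐPₐ = Σ (-inλₐ) Pₐ`. [folklore] -/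
theorem neg_I_mul_smul_sum (lam : Fin r → ℝ) (n : ℝ) :
    (-(Complex.I * n)) • (∑ a, (lam a : ℂ) • P a) = ∑ a, (-(Complex.I * n * lam a)) • P a := by
  rw [Finset.smul_sum]
  refine Finset.sum_congr rfl fun a _ => ?_
  rw [smul_smul, neg_mul, mul_assoc]

/-- `‖exp(t Σ (-inλₐ)Pₐ)‖ ≤ r B_P` for real `t`: the phases are unimodular. [folklore] -/
theorem norm_exp_smul_phase_le (hP : CompleteOrthogonalIdempotents P) (lam : Fin r → ℝ)
    (n t : ℝ) {BP : ℝ} (hBP : ∀ a, ‖P a‖ ≤ BP) :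
    ‖exp (t • ∑ a, (-(Complex.I * n * lam a)) • P a)‖ ≤ r * BP := by
  have h : t • (∑ a, (-(Complex.I * n * lam a)) • P a) =
      ∑ a, (((-(t * n * lam a) : ℝ) : ℂ) * Complex.I) • P a := by
    rw [Finset.smul_sum]
    refine Finset.sum_congr rfl fun a _ => ?_
    rw [← Complex.coe_smul, smul_smul]
    congr 1
    push_cast
    ring
  rw [h]
  exact norm_exp_sum_smul_idempotents_le hP _ (fun a => Complex.norm_exp_ofReal_mul_I _) hBP

/-- The explicit constant of the averaging estimate, as a function of the number `r` of
idempotents, the bound `B_P` on their norms, the bound `B_E` on `‖E‖` and the minimal gap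
`δ`. [folklore] -/
def averagingBound (r : ℕ) (BP BE δ : ℝ) : ℝ :=
  let BA : ℝ := r * BP
  let Bd : ℝ := r * BP ^ 2 * BE
  let Bo : ℝ := BE + Bd
  let BY : ℝ := BA * Real.exp Bd
  let MU : ℝ := Real.exp (BY ^ 2 * Bo)
  BY * ((r : ℝ) ^ 2 * BP ^ 2 * BE / δ *
    ((2 * Bd * BY + BY ^ 3 * Bo) * (BY * MU) + 1 + BY ^ 2 * MU))

/-- **Averaging estimate for `exp(A + E)`, `A = -in Σ λₐPₐ`.** For complete orthogonal
idempotents `Pₐ` with `‖Pₐ‖ ≤ B_P`, pairwise distinct reals `λₐ` with gaps `≥ δ > 0`, a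
matrix `E` with `‖E‖ ≤ B_E` and `n > 0`:
`‖exp(A + E) - exp(A) exp(E_d)‖ ≤ averagingBound r B_P B_E δ / n`, where
`E_d = idemBlockDiag P E` commutes with `A`. [folklore] -/
theorem norm_exp_phase_add_sub_le [Nonempty m] (hP : CompleteOrthogonalIdempotents P)
    {lam : Fin r → ℝ} {δ : ℝ} (hδ : 0 < δ) (hgap : ∀ a b, a ≠ b → δ ≤ |lam a - lam b|)
    {BP BE : ℝ} (hBP : ∀ a, ‖P a‖ ≤ BP) {E : Matrix m m ℂ} (hBE : ‖E‖ ≤ BE) {n : ℝ}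
    (hn : 0 < n) :
    ‖exp ((∑ a, (-(Complex.I * n * lam a)) • P a) + E) -
        exp (∑ a, (-(Complex.I * n * lam a)) • P a) * exp (idemBlockDiag P E)‖ ≤
      averagingBound r BP BE δ / n := by
  set A : Matrix m m ℂ := ∑ a, (-(Complex.I * n * lam a)) • P a with hA
  set Ed := idemBlockDiag P E with hEd
  set Θ := averagingCorrector P lam E n with hΘ
  have hlam : Function.Injective lam := fun a b h => by
    by_contra hab
    have := hgap a b hab
    rw [h, sub_self, abs_zero] at this
    exact absurd this (not_le.2 hδ)
  -- hypotheses of the abstract estimate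
  have hcomm : Commute A Ed := sum_smul_commute_idemBlockDiag hP E _
  have hΘA : Θ * A - A * Θ = E - Ed := averagingCorrector_commutator hP hlam E hn.ne'
  have hAexp : ∀ t : ℝ, |t| ≤ 1 → ‖exp (t • A)‖ ≤ r * BP := fun t _ =>
    norm_exp_smul_phase_le hP lam n t hBP
  have hEd : ‖Ed‖ ≤ r * BP ^ 2 * BE :=
    (norm_idemBlockDiag_le hBP E).trans (mul_le_mul_of_nonneg_left hBE (by positivity))
  have hEo : ‖E - Ed‖ ≤ BE + r * BP ^ 2 * BE := (norm_sub_le _ _).trans (add_le_add hBE hEd)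
  have hΘn : ‖Θ‖ ≤ (r : ℝ) ^ 2 * BP ^ 2 * BE / (n * δ) :=
    (norm_averagingCorrector_le hδ hgap hBP E hn).trans
      (div_le_div_of_nonneg_right (mul_le_mul_of_nonneg_left hBE (by positivity))
        (by positivity))
  have key := norm_exp_add_add_sub_exp_add_le hcomm hΘA hAexp hEd hEo hΘn
  have h1 : A + Ed + (E - Ed) = A + E := by abel
  have h2 : exp (A + Ed) = exp A * exp Ed := Matrix.exp_add_of_commute _ _ hcomm
  rw [h1, h2] at key
  refine key.trans (le_of_eq ?_)
  simp only [averagingBound]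
  field_simp

/-- **The estimate multiplied by a projection**: with `A = -in Σ λ_bP_b`,
`‖exp(A + E) Pₐ - e^{-inλₐ} exp(E_d) Pₐ‖ ≤ B_P · averagingBound / n`, since
`exp(A) exp(E_d) Pₐ = exp(A) Pₐ exp(E_d)`-free form: `exp(A)exp(E_d)Pₐ = e^{-inλₐ}exp(E_d)Pₐ`
(`E_d` commutes with `Pₐ`, and `exp(A)Pₐ = e^{-inλₐ}Pₐ`). [folklore] -/
theorem norm_exp_phase_add_mul_idem_sub_le [Nonempty m] (hP : CompleteOrthogonalIdempotents P)
    {lam : Fin r → ℝ} {δ : ℝ} (hδ : 0 < δ) (hgap : ∀ a b, a ≠ b → δ ≤ |lam a - lam b|)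
    {BP BE : ℝ} (hBP : ∀ a, ‖P a‖ ≤ BP) {E : Matrix m m ℂ} (hBE : ‖E‖ ≤ BE) {n : ℝ}
    (hn : 0 < n) (a : Fin r) :
    ‖exp ((∑ b, (-(Complex.I * n * lam b)) • P b) + E) * P a -
        Complex.exp (-(Complex.I * n * lam a)) • (exp (idemBlockDiag P E) * P a)‖ ≤
      BP * averagingBound r BP BE δ / n := by
  have hBP0 : 0 ≤ BP := (norm_nonneg _).trans (hBP a)
  have hc : Commute (exp (idemBlockDiag P E)) (P a) := (idem_commute_idemBlockDiag hP E a).symm.exp_left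
  have hid : exp (∑ b, (-(Complex.I * n * lam b)) • P b) * exp (idemBlockDiag P E) * P a =
      Complex.exp (-(Complex.I * n * lam a)) • (exp (idemBlockDiag P E) * P a) := by
    rw [Matrix.mul_assoc, hc.eq, ← Matrix.mul_assoc, exp_sum_smul_mul_idempotent hP _ a,
      Matrix.smul_mul, ← hc.eq]
  rw [← hid, ← Matrix.sub_mul]
  calc ‖(exp ((∑ b, (-(Complex.I * n * lam b)) • P b) + E) -
        exp (∑ b, (-(Complex.I * n * lam b)) • P b) * exp (idemBlockDiag P E)) * P a‖
      ≤ ‖exp ((∑ b, (-(Complex.I * n * lam b)) • P b) + E) -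
        exp (∑ b, (-(Complex.I * n * lam b)) • P b) * exp (idemBlockDiag P E)‖ * ‖P a‖ :=
        norm_mul_le _ _
    _ ≤ averagingBound r BP BE δ / n * BP :=
        mul_le_mul (norm_exp_phase_add_sub_le hP hδ hgap hBP hBE hn) (hBP a) (norm_nonneg _)
          (by
            have h := norm_exp_phase_add_sub_le hP hδ hgap hBP hBE hn
            exact (norm_nonneg _).trans h)
    _ = BP * averagingBound r BP BE δ / n := by ring

end Phase

end Literature.Analysis.ODE

end
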